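import Summits.QuantumFields.YangMills.Theorems.UnitScaleTiltProp7SectET3GaugeProjectorT3
import HarnessLib

/-!
# Route `UnitScaleTilt`, crux K1 «MinimiserStabilityRegPr» (stmt-QuantumFields-19200), route-R E′, architecture (A′) «HCOW-VIA-Σ» (★★OWNER RULING g28-№13), package P-A4
# «CRUDE SLICE ON PRINT'S SLICE» — FILE V1 «THE VARIATIONAL PRINCIPLE ON `ker R`»: a gauge parameter `f` with `R(U₀) f = 0` is the MINIMAL-ENERGY representative of its
# residual-gauge class `f + N(U₀)` (`‖D_{U₀}(f + λ)‖² = ‖D_{U₀} f‖² + ‖D_{U₀} λ‖²` for `λ ∈ N`), hence BERNSTEIN on `ker R` ⟸ ONE COMPETITOR per `f`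
# («`∃ λ ∈ N, ‖D_{U₀}(f + λ)‖² ≤ C·‖f‖²`») — the hypothesis `hBern` of ✓ `Prop7HessOnPrintSlice.div_sq_le_of_bernstein_ker_RS_of_isLandauPrintS` from a competitor row

Cell `ym3-torus`, width seat `ym3-torus-px19` (gen 5); LOCATE «P-A4 CURVED IS ELEMENTARY — VARIATIONAL PRINCIPLE + COVARIANT BUBBLE COMPETITOR» (HOME
`ym3-torus-px19/g5/LOCATE-PA4-VARIATIONAL-px19g5.md`, 19200 evidence) §0 (V), §1.  WHY: print's gauge projector `R(U₀)` ((3.21)) is the ORTHOGONAL projection onto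
`Δ^η_{U₀}·N`, `N = N(Q′)` the residual gauge algebra, and `Δ^η_{U₀} = D*_{U₀}D_{U₀}` with `D*` the adjoint of `D` (p. 392) — so `Rf = 0` says `D_{U₀}f ⊥ D_{U₀}N`, and the
Bernstein∕reverse-Poincaré inequality on `ker R` that the crude slice needs (consumer ✓p687224) reduces to exhibiting, for each `f`, ANY element of `f + N` with energy
`≤ C‖f‖²` (the LOCATE's bubble competitor does that at flat and curved regular backgrounds with `C` absolute — files V2∕V3).  THEOREMS ONLY (0 `def`, 0 `sorry`);
`--supports stmt-QuantumFields-19200 --as helper`, count-neutral.  YM₃ on T³ is a ladder rung (R3), not the Clay problem; nothing here claims `hBern`, HESS, `hcoW`, E′, a stub,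
the crux, d = 4 or the mass gap.

WHAT IS PROVED (ns `…Theorems.Prop7BernsteinKerRSVariational`).
* §1a (abstract, MULTIPLIER form — print's (1.38) «`Δ(D*A) = Q′ᵀμ`», no projector object): ★ `inner_D_eq_zero_of_adjoint_D_D_eq` (`D†(Df) = g`, `g ⊥ l` ⊢ `⟪Dl, Df⟫ = 0`),
  ★★ `norm_D_add_sq_of_adjoint_D_D_eq` (Pythagoras), ★★★ `bernstein_of_competitor_adjoint_D_D_eq` (one competitor `f + l`, `g ⊥ l`, `‖D(f+l)‖² ≤ C‖f‖²` ⊢ `‖Df‖² ≤ C‖f‖²`).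
* §1b (abstract, PROJECTOR form over lit `B11Eq103H1Complex.projR`; any `RCLike 𝕜`, finite-dimensional inner-product spaces `E F`, any linear `D : E → F`, `Q′ : E → F′`):
  ★ `inner_D_eq_zero_of_projR_eq_zero` — `projR (D†∘D) Q′ f = 0`, `Q′ l = 0` ⊢ `⟪D l, D f⟫ = 0`;
  ★★ `norm_D_add_sq_of_projR_eq_zero` — Pythagoras `‖D(f + l)‖² = ‖D f‖² + ‖D l‖²`; ★★ `norm_D_sq_le_of_projR_eq_zero` — `‖D f‖² ≤ ‖D(f + l)‖²`;
  ★★★ `bernstein_of_competitor_projR` — `(∀ f, ∃ l, Q′ l = 0 ∧ ‖D(f + l)‖² ≤ C‖f‖²) → ∀ f, projR (D†∘D) Q′ f = 0 → ‖D f‖² ≤ C‖f‖²`.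
* §2 (the member letters `RS`, `NS`∕`QDS`, `DL2`, `covLapSite` of ✓ `Prop7SectET3GaugeProjector` ∕ ✓ `Prop7SectET3HilbertLetters`, ANY background `U₀`, any weights `c₀ cB`):
  ★ `covLapSite_eq_adjoint_comp` (`Δ^η_{U₀} = (D_{U₀})† ∘ D_{U₀}`, ✓ `adjoint_DL2`); ★★ `inner_DL2_eq_zero_of_RS_eq_zero`; ★★ `norm_DL2_add_sq_of_RS_eq_zero`;
  ★★ `norm_DL2_sq_le_of_RS_eq_zero`; ★★★ `hBern_of_competitorRow` — `(∀ f, ∃ l, QDS U₀ l = 0 ∧ ‖DL2 U₀ (f + l)‖² ≤ C‖f‖²) → (∀ f, RS U₀ f = 0 → ‖DL2 U₀ f‖² ≤ C‖f‖²)`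
  = ✓p687224's `hBern` VERBATIM.
HONEST SCOPE.  Hilbert-space bookkeeping (Mathlib `Submodule.starProjection` orthogonality); no estimate; the competitor row is DISPLAYED (files V2∕V3 of the LOCATE supply it).

References: T. Bałaban, CMP 99 (1985) 389–434 [Balaban1985BackgroundPropagators] ((3.8) p.392 «D* is the adjoint of D», (3.20)–(3.23) p.394); CMP 96 (1984) 223–250
[Balaban1984PropagatorsII] ((2.7)–(2.12) pp.224–225: the flat `N(Q′)`, `R`).
-/

set_option autoImplicit false

noncomputable section

open scoped InnerProductSpace ComplexConjugate

namespace Summit.QuantumFields.YangMills.Theorems.Prop7BernsteinKerRSVariational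

open Literature.MathematicalPhysics.QuantumFieldTheory.Balaban1983to89
open Literature.MathematicalPhysics.QuantumFieldTheory.Balaban1983to89.T3ContinuumYM3Torus
open B11Eq103H1Complex (SiteL2K BondL2K projR)
open Summit.QuantumFields.YangMills.Theorems.Prop7SectET3Transport (periodsT3)
open Summit.QuantumFields.YangMills.Theorems.Prop7SectET3HilbertLetters (W₂ DL2 DstarL2 covLapSite adjoint_DL2)
open Summit.QuantumFields.YangMills.Theorems.Prop7SectET3GaugeProjector (QDS NS RS RS_eq_projR)

/-! ## §1 The variational principle on `ker R`, abstract (lit `projR`) -/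

section Abstract

variable {𝕜 : Type*} [RCLike 𝕜] {E : Type*} [NormedAddCommGroup E] [InnerProductSpace 𝕜 E] [FiniteDimensional 𝕜 E]
  {F : Type*} [NormedAddCommGroup F] [InnerProductSpace 𝕜 F] [FiniteDimensional 𝕜 F]
  {F' : Type*} [AddCommGroup F'] [Module 𝕜 F']

/-! ### §1a Multiplier form (print's (1.38)∕[B8] (138) «`Δ_{U₀}(D*A) = Q′ᵀμ`»): no projector object, only `⟪Q′ᵀμ, λ⟫ = 0` on `ker Q′` -/

/-- ★ **MULTIPLIER FORM OF `ker R`**: if `D†(D f) = g` and `g ⊥ l` (e.g. `g = Q′ᵀμ`, `Q′ l = 0`, by the adjointness of `Q′ᵀ`), then `⟪D l, D f⟫ = 0`.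
[cite: Balaban1985RegularSpaces, (1.38) p.82; Balaban1985BackgroundPropagators, (3.8) p.392, (3.22) p.394] -/
theorem inner_D_eq_zero_of_adjoint_D_D_eq (D : E →ₗ[𝕜] F) {f l g : E} (hf : LinearMap.adjoint D (D f) = g) (hgl : ⟪g, l⟫_𝕜 = 0) :
    ⟪D l, D f⟫_𝕜 = 0 := by
  rw [inner_eq_zero_symm, ← LinearMap.adjoint_inner_left, hf]
  exact hgl

/-- ★★ **PYTHAGORAS, MULTIPLIER FORM**: `D†(D f) = g`, `g ⊥ l` ⊢ `‖D(f + l)‖² = ‖D f‖² + ‖D l‖²`. [cite: Balaban1985RegularSpaces, (1.38) p.82; Balaban1985BackgroundPropagators, (3.22) p.394] -/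
theorem norm_D_add_sq_of_adjoint_D_D_eq (D : E →ₗ[𝕜] F) {f l g : E} (hf : LinearMap.adjoint D (D f) = g) (hgl : ⟪g, l⟫_𝕜 = 0) :
    ‖D (f + l)‖ ^ 2 = ‖D f‖ ^ 2 + ‖D l‖ ^ 2 := by
  have h0 : ⟪D f, D l⟫_𝕜 = 0 := by
    rw [inner_eq_zero_symm]; exact inner_D_eq_zero_of_adjoint_D_D_eq D hf hgl
  have h := norm_add_sq_eq_norm_sq_add_norm_sq_of_inner_eq_zero (D f) (D l) h0
  rw [map_add, sq, sq, sq]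
  exact h

/-- ★★★ **BERNSTEIN FROM A COMPETITOR, MULTIPLIER FORM**: `D†(D f) = g` and a competitor `f + l` with `g ⊥ l`, `‖D(f + l)‖² ≤ C‖f‖²` ⊢ `‖D f‖² ≤ C‖f‖²`.
[cite: Balaban1985RegularSpaces, (1.38) p.82; Balaban1984PropagatorsII, (2.7)-(2.12) pp.224-225] -/
theorem bernstein_of_competitor_adjoint_D_D_eq (D : E →ₗ[𝕜] F) {f l g : E} {C : ℝ} (hf : LinearMap.adjoint D (D f) = g) (hgl : ⟪g, l⟫_𝕜 = 0)
    (hle : ‖D (f + l)‖ ^ 2 ≤ C * ‖f‖ ^ 2) : ‖D f‖ ^ 2 ≤ C * ‖f‖ ^ 2 := by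
  rw [norm_D_add_sq_of_adjoint_D_D_eq D hf hgl] at hle
  nlinarith [sq_nonneg ‖D l‖]

/-! ### §1b Projector form (print's `R(U₀)` of (3.21) = lit `projR`; the hook ✓p687224's letter) -/

/-- ★ **`R f = 0` MEANS `D f ⊥ D N`**: for `Δs = D† ∘ D` and `R = projR Δs Q′` (the orthogonal projection onto `Δs·ker Q′`), `R f = 0` and `Q′ l = 0` give `⟪D l, D f⟫ = 0`.
[cite: Balaban1985BackgroundPropagators, (3.21)-(3.23) p.394, (3.8) p.392] -/
theorem inner_D_eq_zero_of_projR_eq_zero (D : E →ₗ[𝕜] F) (Q' : E →ₗ[𝕜] F') {f l : E}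
    (hf : projR (LinearMap.adjoint D ∘ₗ D) Q' f = 0) (hl : Q' l = 0) : ⟪D l, D f⟫_𝕜 = 0 := by
  haveI : CompleteSpace ((LinearMap.ker Q').map (LinearMap.adjoint D ∘ₗ D)) := FiniteDimensional.complete 𝕜 _
  have hmem : f ∈ ((LinearMap.ker Q').map (LinearMap.adjoint D ∘ₗ D))ᗮ :=
    (Submodule.starProjection_apply_eq_zero_iff _).1 hf
  have h := (Submodule.mem_orthogonal _ f).1 hmem ((LinearMap.adjoint D ∘ₗ D) l)
    (Submodule.mem_map_of_mem (LinearMap.mem_ker.2 hl))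
  rwa [LinearMap.comp_apply, LinearMap.adjoint_inner_left] at h

/-- ★★ **PYTHAGORAS ON `ker R`**: `R f = 0`, `Q′ l = 0` ⊢ `‖D(f + l)‖² = ‖D f‖² + ‖D l‖²` — `f` is the minimal-energy representative of `f + N(Q′)`.
[cite: Balaban1985BackgroundPropagators, (3.21)-(3.23) p.394] -/
theorem norm_D_add_sq_of_projR_eq_zero (D : E →ₗ[𝕜] F) (Q' : E →ₗ[𝕜] F') {f l : E}
    (hf : projR (LinearMap.adjoint D ∘ₗ D) Q' f = 0) (hl : Q' l = 0) : ‖D (f + l)‖ ^ 2 = ‖D f‖ ^ 2 + ‖D l‖ ^ 2 := by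
  have h0 : ⟪D f, D l⟫_𝕜 = 0 := by
    rw [inner_eq_zero_symm]; exact inner_D_eq_zero_of_projR_eq_zero D Q' hf hl
  have h := norm_add_sq_eq_norm_sq_add_norm_sq_of_inner_eq_zero (D f) (D l) h0
  rw [map_add, sq, sq, sq]
  exact h

/-- ★★ **MINIMALITY**: `R f = 0`, `Q′ l = 0` ⊢ `‖D f‖² ≤ ‖D(f + l)‖²`. [cite: Balaban1985BackgroundPropagators, (3.21)-(3.23) p.394] -/
theorem norm_D_sq_le_of_projR_eq_zero (D : E →ₗ[𝕜] F) (Q' : E →ₗ[𝕜] F') {f l : E}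
    (hf : projR (LinearMap.adjoint D ∘ₗ D) Q' f = 0) (hl : Q' l = 0) : ‖D f‖ ^ 2 ≤ ‖D (f + l)‖ ^ 2 := by
  rw [norm_D_add_sq_of_projR_eq_zero D Q' hf hl]
  exact le_add_of_nonneg_right (sq_nonneg _)

/-- ★★★ **BERNSTEIN ON `ker R` FROM A COMPETITOR ROW**: if every `f` has a competitor `f + l`, `Q′ l = 0`, with `‖D(f + l)‖² ≤ C‖f‖²`, then `‖D f‖² ≤ C‖f‖²` on `ker R`.
[cite: Balaban1985BackgroundPropagators, (3.21)-(3.23) p.394; Balaban1984PropagatorsII, (2.7)-(2.12) pp.224-225] -/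
theorem bernstein_of_competitor_projR (D : E →ₗ[𝕜] F) (Q' : E →ₗ[𝕜] F') {C : ℝ}
    (hcomp : ∀ f : E, ∃ l : E, Q' l = 0 ∧ ‖D (f + l)‖ ^ 2 ≤ C * ‖f‖ ^ 2) :
    ∀ f : E, projR (LinearMap.adjoint D ∘ₗ D) Q' f = 0 → ‖D f‖ ^ 2 ≤ C * ‖f‖ ^ 2 := by
  intro f hf
  obtain ⟨l, hl, hle⟩ := hcomp f
  exact (norm_D_sq_le_of_projR_eq_zero D Q' hf hl).trans hle

end Abstract

/-! ## §2 The member letters: `RS`, `QDS`∕`NS`, `DL2`, `covLapSite` -/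

section Member

variable (F : T3Family) (n K : ℕ) (h : n ≤ K) (c₀ cB : ℝ) [Fact (0 < c₀)]

/-- ★ `Δ^η_{U₀} = (D_{U₀})† ∘ D_{U₀}` on the weighted `L²` spaces (✓ `covLapSite = DstarL2 ∘ DL2`, ✓ `adjoint_DL2`). [cite: Balaban1985BackgroundPropagators, (3.8) p.392, (3.23) p.394] -/
theorem covLapSite_eq_adjoint_comp (U₀ : GaugeField (F.P K) 0 (Matrix.specialUnitaryGroup (Fin 2) ℂ)) :
    covLapSite F n K c₀ U₀ = LinearMap.adjoint (DL2 F n K c₀ U₀) ∘ₗ DL2 F n K c₀ U₀ := by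
  rw [adjoint_DL2]; rfl

/-- ★★ **`R_S(U₀) f = 0` MEANS `D_{U₀} f ⊥ D_{U₀} N_S(U₀)`**: `RS U₀ f = 0` and `Q(U₀)(D_{U₀} l) = 0` give `⟪D_{U₀} l, D_{U₀} f⟫ = 0`.
[cite: Balaban1985BackgroundPropagators, (3.21)-(3.23) p.394, (3.115) p.418] -/
theorem inner_DL2_eq_zero_of_RS_eq_zero (U₀ : GaugeField (F.P K) 0 (Matrix.specialUnitaryGroup (Fin 2) ℂ)) {f l : SiteL2K ℂ 3 (periodsT3 F K) c₀ W₂}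
    (hf : RS F n K h c₀ cB U₀ f = 0) (hl : QDS F n K h c₀ cB U₀ l = 0) : ⟪DL2 F n K c₀ U₀ l, DL2 F n K c₀ U₀ f⟫_ℂ = 0 := by
  rw [RS_eq_projR, covLapSite_eq_adjoint_comp] at hf
  exact inner_D_eq_zero_of_projR_eq_zero _ _ hf hl

/-- ★★ **PYTHAGORAS ON `ker R_S(U₀)`**: `RS U₀ f = 0`, `l ∈ N_S(U₀)` ⊢ `‖D_{U₀}(f + l)‖² = ‖D_{U₀} f‖² + ‖D_{U₀} l‖²`.
[cite: Balaban1985BackgroundPropagators, (3.21)-(3.23) p.394] -/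
theorem norm_DL2_add_sq_of_RS_eq_zero (U₀ : GaugeField (F.P K) 0 (Matrix.specialUnitaryGroup (Fin 2) ℂ)) {f l : SiteL2K ℂ 3 (periodsT3 F K) c₀ W₂}
    (hf : RS F n K h c₀ cB U₀ f = 0) (hl : QDS F n K h c₀ cB U₀ l = 0) :
    ‖DL2 F n K c₀ U₀ (f + l)‖ ^ 2 = ‖DL2 F n K c₀ U₀ f‖ ^ 2 + ‖DL2 F n K c₀ U₀ l‖ ^ 2 := by
  rw [RS_eq_projR, covLapSite_eq_adjoint_comp] at hf
  exact norm_D_add_sq_of_projR_eq_zero _ _ hf hl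

/-- ★★ **MINIMALITY ON `ker R_S(U₀)`**: `RS U₀ f = 0`, `l ∈ N_S(U₀)` ⊢ `‖D_{U₀} f‖² ≤ ‖D_{U₀}(f + l)‖²`. [cite: Balaban1985BackgroundPropagators, (3.21)-(3.23) p.394] -/
theorem norm_DL2_sq_le_of_RS_eq_zero (U₀ : GaugeField (F.P K) 0 (Matrix.specialUnitaryGroup (Fin 2) ℂ)) {f l : SiteL2K ℂ 3 (periodsT3 F K) c₀ W₂}
    (hf : RS F n K h c₀ cB U₀ f = 0) (hl : QDS F n K h c₀ cB U₀ l = 0) :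
    ‖DL2 F n K c₀ U₀ f‖ ^ 2 ≤ ‖DL2 F n K c₀ U₀ (f + l)‖ ^ 2 := by
  rw [RS_eq_projR, covLapSite_eq_adjoint_comp] at hf
  exact norm_D_sq_le_of_projR_eq_zero _ _ hf hl

/-- The same with `l ∈ N_S(U₀)` stated as submodule membership (✓ `NS = ker QDS`). [cite: Balaban1985BackgroundPropagators, (3.21) p.394] -/
theorem norm_DL2_sq_le_of_RS_eq_zero_of_mem_NS (U₀ : GaugeField (F.P K) 0 (Matrix.specialUnitaryGroup (Fin 2) ℂ)) {f l : SiteL2K ℂ 3 (periodsT3 F K) c₀ W₂}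
    (hf : RS F n K h c₀ cB U₀ f = 0) (hl : l ∈ NS F n K h c₀ cB U₀) :
    ‖DL2 F n K c₀ U₀ f‖ ^ 2 ≤ ‖DL2 F n K c₀ U₀ (f + l)‖ ^ 2 :=
  norm_DL2_sq_le_of_RS_eq_zero F n K h c₀ cB U₀ hf (LinearMap.mem_ker.1 hl)

/-- ★★★ **`hBern` FROM A COMPETITOR ROW** (the hypothesis of ✓ `Prop7HessOnPrintSlice.div_sq_le_of_bernstein_ker_RS_of_isLandauPrintS`, VERBATIM, at any background `U₀`):
if every gauge parameter `f` has a competitor `f + l` with `Q(U₀)(D_{U₀} l) = 0` and `‖D_{U₀}(f + l)‖² ≤ C·‖f‖²`, then `‖D_{U₀} f‖² ≤ C·‖f‖²` for every `f` with `R_S(U₀) f = 0`.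
[cite: Balaban1985BackgroundPropagators, (3.21)-(3.23) p.394, (3.115) p.418; Balaban1984PropagatorsII, (2.7)-(2.12) pp.224-225] -/
theorem hBern_of_competitorRow (U₀ : GaugeField (F.P K) 0 (Matrix.specialUnitaryGroup (Fin 2) ℂ)) {C : ℝ}
    (hcomp : ∀ f : SiteL2K ℂ 3 (periodsT3 F K) c₀ W₂, ∃ l : SiteL2K ℂ 3 (periodsT3 F K) c₀ W₂,
      QDS F n K h c₀ cB U₀ l = 0 ∧ ‖DL2 F n K c₀ U₀ (f + l)‖ ^ 2 ≤ C * ‖f‖ ^ 2) :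
    ∀ f : SiteL2K ℂ 3 (periodsT3 F K) c₀ W₂, RS F n K h c₀ cB U₀ f = 0 → ‖DL2 F n K c₀ U₀ f‖ ^ 2 ≤ C * ‖f‖ ^ 2 := by
  intro f hf
  obtain ⟨l, hl, hle⟩ := hcomp f
  exact (norm_DL2_sq_le_of_RS_eq_zero F n K h c₀ cB U₀ hf hl).trans hle

end Member

end Summit.QuantumFields.YangMills.Theorems.Prop7BernsteinKerRSVariational

end
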